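import Literature.Topology.FourManifolds.SliverRegluingNbhd
import Literature.Topology.FourManifolds.MappingTorusFibreTwist
import Literature.Topology.FourManifolds.CircleNbhdTransport
import Literature.Topology.FourManifolds.CappellShanesonDeltaMove
import Literature.Topology.FourManifolds.StraighteningInvariance
import HarnessLib

/-!
# Gompf's Theorem 2.1 for the framed row move, reduced to the fishtail regluing of `X^σ_B`

Assembly brick of the geometric core of R. Gompf, *More Cappell–Shaneson spheres are standard*,
Algebr. Geom. Topol. 10 (2010), Theorem 2.1 / §4 ¶3, towards the named facts
`Literature.Topology.FourManifolds.gompf2010_framedTwist` (**F**) and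
`Literature.Topology.FourManifolds.gompf2010_framedTwistZero` (**F₀**). The single framed row move
`gompfSphere B β ≃ₘ gompfSphere (Δ B) (β.deltaLeft 1)` (from which F follows,
`gompf2010_framedTwist_of_one`, and then F₀, `gompf2010_framedTwistZero_of_framedTwist`) is
proved here **conditionally on the fishtail regluing of `X^σ_B` itself** — the only geometric
input of Theorem 2.1 that is not plumbing: the hypothesis `hX` of
`nonempty_diffeomorph_gompfSphere_deltaLeft_one_of_reglue` says that the surgered manifold
`X = gompfSphere B β` is an open gluing of `X` minus the fibre sliver and of the half
`{re z₂ < 0} × (1/2, 3/2)` of the second cylinder (a neighbourhood of the sliver) along the relation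
"reglue by the Dehn twist `δ` across the sliver" (`SliverRegluingNbhd.lean`), which is what Gompf's fishtail neighbourhood and Lemma 2.2
provide ("the diffeomorphism type of `X^ε_φ` is unchanged if we cut out `N'` and reglue it by a
`k`-fold Dehn twist … equivalently, precede the surgery by cutting along an `M`-fiber and
regluing by `δᵏ`").

Given that, the chain is (all proved here or in the imported bricks):
* `T' = CSTorus (Δ B)` with the cylinders reparametrised by the straight-line diffeotopy
  `D_t = torusTwist (e^{i t (θ - f θ)})` from `id` to `Δ ∘ δ⁻¹` (`MappingTorusFibreTwist.lean`) is a
  mapping torus of `δ ∘ B` (`isOpenGluingWith_csTorus_dehn`) — Gompf §3/§4 ¶3: "`δ` is isotopic to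
  the linear diffeomorphism `Δ`", "our isotopy from `δᵏ` to `Δᵏ` changes the bundle monodromy to
  `B` while changing the straightening to `τ·σ`";
* cutting `T = CSTorus B` and `T'` along the sliver `S × {1}` (`S` the collar supporting `δ`)
  identifies them (`MappingTorusSliver.lean`), and the surgeries off the sliver
  (`CircleSurgeryLocal.lean`, `MappingTorusSliverSurgery.lean`), so that the surgered `T'` along
  the transported tube `ν' = Θ ∘ ν_β` is an open gluing along the same relation as in `hX`;
  uniqueness of open gluings gives `X ≅ ν'.Surgered`;
* **the transported Gompf tube is a Gompf tube**: because `D_t` and `δ` are *linear* resp. the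
  identity on the (thin) tube, `ν'` is given by Gompf's formula for the matrix `Δ B`, the framing
  path `β₁(u) = Δ_{μ(u/2)} β(u)` (`deltaTwistPath`) and the radius of `ν_β`; it agrees with
  `sectionCircleNbhd (Δ B) β₁` up to the fibre rescaling of `TubeReparam`/`FibreStraightening`, so
  the surgeries agree, and finally `[β₁] = [β.deltaLeft 1]` as straightenings (a square homotopy),
  so W (`gompf2010_straightening_invariance_holds`) finishes.

No named facts are introduced; everything in this file is proved.

## References

* R. E. Gompf, *More Cappell–Shaneson spheres are standard*, Algebr. Geom. Topol. 10 (2010)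
  1665–1681: Thm 2.1 and its proof (last paragraph), Lemma 2.2, §3 ("`δ` is isotopic to `Δ`"),
  §4 ¶3 (`X^{τ·σ}_B = X^σ_A`). [GompfAGT2010]
* R. E. Gompf, A. I. Stipsicz, *4-Manifolds and Kirby Calculus*, GSM 20 (1999), §5.2.
  [GompfStipsiczGSM1999]
-/

open scoped Manifold ContDiff Topology Real unitInterval
open Set Function Metric

noncomputable section

namespace Literature.Topology.FourManifolds

universe u

/-- Local notation: `𝔼 n` is the model Euclidean space `EuclideanSpace ℝ (Fin n)`. -/
local notation "𝔼 " n:arg => EuclideanSpace ℝ (Fin n)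

/-- Local notation: `𝕊 n` is the unit sphere in `EuclideanSpace ℝ (Fin (n + 1))`. -/
local notation "𝕊 " n:arg => (Metric.sphere (0 : EuclideanSpace ℝ (Fin (n + 1))) 1)

/-- Local notation: the model with corners `𝓣 = (𝓡 1).prod ((𝓡 1).prod (𝓡 1))` of `ThreeTorus`. -/
local notation "𝓣" =>
  (ModelWithCorners.prod (𝓡 1) (ModelWithCorners.prod (𝓡 1) (𝓡 1)))

attribute [local instance] fact_finrank_euclideanSpace_succ finrank_real_complex_fact'

/-! ### The real unipotent matrices `Δ_r = 1 + r N` -/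

section DeltaReal

/-- **The real one-parameter group through Gompf's `Δ`**: `Δ_r = !![1, -r, 0; 0, 1, 0; 0, r, 1]`
(`Δ_1 = Δ`, `Δ_r Δ_s = Δ_{r+s}` since `N² = 0`); `Δ_r` is the linear part at the base point of the
straight-line isotopy from `id` to `Δ ∘ δ⁻¹` and the segment of the row move. [cite: GompfAGT2010, §3 (the matrix Δ) and §4 ¶3 (the linear path τ)] -/
def gompfDeltaReal (r : ℝ) : Matrix (Fin 3) (Fin 3) ℝ := !![1, -r, 0; 0, 1, 0; 0, r, 1]

/-- `Δ_0 = 1`. [folklore] -/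
@[simp] theorem gompfDeltaReal_zero : gompfDeltaReal 0 = 1 := by
  ext i j
  fin_cases i <;> fin_cases j <;> simp [gompfDeltaReal]

/-- `Δ_r Δ_s = Δ_{r + s}`. [folklore] -/
theorem gompfDeltaReal_mul (r s : ℝ) : gompfDeltaReal r * gompfDeltaReal s = gompfDeltaReal (r + s) := by
  ext i j
  fin_cases i <;> fin_cases j <;>
    simp [gompfDeltaReal, Matrix.mul_apply, Fin.sum_univ_three]

/-- `Δ_1` is the real matrix of Gompf's `Δ`. [cite: GompfAGT2010, §3 (the matrix Δ)] -/
theorem slRealMatrix_gompfDelta : slRealMatrix gompfDelta = gompfDeltaReal 1 := by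
  ext i j
  fin_cases i <;> fin_cases j <;>
    simp [slRealMatrix, gompfDelta, gompfDeltaReal]

/-- `Δ_1` is the real matrix of `Δ ^ 1`. [folklore] -/
theorem slRealMatrix_gompfDelta_zpow_one :
    slRealMatrix (gompfDelta ^ (1 : ℤ)) = gompfDeltaReal 1 := by
  rw [zpow_one, slRealMatrix_gompfDelta]

/-- The coordinates of `Δ_r v`: `(v₀ - r v₁, v₁, v₂ + r v₁)`. [folklore] -/
theorem mulVecE_gompfDeltaReal_apply (r : ℝ) (v : 𝔼 3) :
    mulVecE (gompfDeltaReal r) v 0 = v 0 - r * v 1 ∧ mulVecE (gompfDeltaReal r) v 1 = v 1 ∧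
      mulVecE (gompfDeltaReal r) v 2 = v 2 + r * v 1 := by
  refine ⟨?_, ?_, ?_⟩ <;> simp [mulVecE_apply, gompfDeltaReal, Fin.sum_univ_three] <;> ring

/-- The entries of `r ↦ Δ_{l r}` are smooth for smooth `l`. [folklore] -/
theorem contDiff_gompfDeltaReal_apply {l : ℝ → ℝ} (hl : ContDiff ℝ ∞ l) (i j : Fin 3) :
    ContDiff ℝ ∞ fun u ↦ gompfDeltaReal (l u) i j := by
  fin_cases i <;> fin_cases j <;>
    simp [gompfDeltaReal] <;> fun_prop

/-- `det Δ_r = 1`. [folklore] -/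
theorem det_gompfDeltaReal (r : ℝ) : (gompfDeltaReal r).det = 1 := by
  simp [gompfDeltaReal, Matrix.det_fin_three]

end DeltaReal

/-! ### Twists of `T³` in exponential coordinates -/

section TorusLemmas

/-- A twist fixes the points where its circle map is `1`. [folklore] -/
theorem torusTwist_eq_self_of {F : Circle → Circle} {z : ThreeTorus} (hF : F z.2.1 = 1) :
    torusTwist F z = z := by
  obtain ⟨a, b, c⟩ := z
  simp only [torusTwist] at hF ⊢
  simp [hF]

/-- **A twist is linear in exponential coordinates**: if the circle map takes `e^{i v₁}` to
`e^{i r v₁}`, then `torusTwist F (expT v) = expT (Δ_r v)`. [folklore] -/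
theorem torusTwist_expT_of {F : Circle → Circle} {v : 𝔼 3} {r : ℝ}
    (hF : F (Circle.exp (v 1)) = Circle.exp (r * v 1)) :
    torusTwist F (expT v) = expT (mulVecE (gompfDeltaReal r) v) := by
  obtain ⟨h0, h1, h2⟩ := mulVecE_gompfDeltaReal_apply r v
  apply torusCoord_injective
  funext j
  have hv1 : (expT v).2.1 = Circle.exp (v 1) := rfl
  fin_cases j
  · show (expT v).1 * (F (expT v).2.1)⁻¹ = torusCoord (expT (mulVecE (gompfDeltaReal r) v)) 0
    rw [torusCoord_expT, h0, hv1, hF, sub_eq_add_neg, Circle.exp_add, Circle.exp_neg]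
    rfl
  · show (expT v).2.1 = torusCoord (expT (mulVecE (gompfDeltaReal r) v)) 1
    rw [torusCoord_expT, h1]
    rfl
  · show (expT v).2.2 * F (expT v).2.1 = torusCoord (expT (mulVecE (gompfDeltaReal r) v)) 2
    rw [torusCoord_expT, h2, hv1, hF, Circle.exp_add]
    rfl

/-- **The circle map of a lift at `e^{iθ}`, `θ ∈ (-π, π]`**: `circleMapOfLift g (e^{iθ}) = e^{i g θ}`
(no periodicity needed on the fundamental domain). [folklore] -/
theorem circleMapOfLift_exp_of_mem (g : ℝ → ℝ) {θ : ℝ} (hθ : θ ∈ Ioc (-π) π) :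
    circleMapOfLift g (Circle.exp θ) = Circle.exp (g θ) := by
  rw [circleMapOfLift, Circle.arg_exp hθ.1 hθ.2]

end TorusLemmas

/-! ### A Dehn-twist lift supported in a thin collar opposite to the base point -/

section Lift

/-- **The far lift** with margin `τ`: Gompf's staircase shifted so that its step sits in the arc
`[π - τ, π + τ/4]` of values of `arg z₂`, opposite to the base point; it vanishes on
`(-(π - τ/2), π - τ]`, so the resulting twist of `T³` is the identity wherever `|arg z₂| < π - τ`
(in particular on a thin tube around the section circle). [cite: GompfAGT2010, §2 (definition of δ after Thm 2.1: p outside the support of δ)] -/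
def farLift (τ : ℝ) (θ : ℝ) : ℝ := gompfLift (π - 3 * τ / 2) (π - τ / 4) (θ - τ / 2)

variable {τ : ℝ}

/-- The parameters of the shifted staircase are admissible. [folklore] -/
theorem farLift_params (hτ : 0 < τ) (hτ' : τ < π / 2) :
    0 < π - 3 * τ / 2 ∧ π - 3 * τ / 2 < π - τ / 4 ∧ π - τ / 4 < π := by
  refine ⟨?_, ?_, ?_⟩ <;> linarith [Real.pi_pos]

/-- The far lift is smooth. [folklore] -/
theorem contDiff_farLift (hτ : 0 < τ) (hτ' : τ < π / 2) : ContDiff ℝ ∞ (farLift τ) := by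
  obtain ⟨h1, h2, h3⟩ := farLift_params hτ hτ'
  exact (contDiff_gompfLift h1 h2 h3).comp (contDiff_id.sub contDiff_const)

/-- The far lift has degree one. [folklore] -/
theorem farLift_add_two_pi (τ θ : ℝ) : farLift τ (θ + 2 * π) = farLift τ θ + 2 * π := by
  unfold farLift
  rw [show θ + 2 * π - τ / 2 = (θ - τ / 2) + 2 * π by ring, gompfLift_add_two_pi]

/-- The far lift has degree one (in the form used by `torusDehnTwist`). [folklore] -/
theorem farLift_periodic (τ θ : ℝ) : farLift τ (θ + 2 * π) = farLift τ θ + 2 * π * ((1 : ℤ) : ℝ) := by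
  rw [farLift_add_two_pi]; push_cast; ring

/-- **The far lift vanishes on `(-(π - τ/2), π - τ]`.** [folklore] -/
theorem farLift_eq_zero (hτ : 0 < τ) (hτ' : τ < π / 2) {θ : ℝ} (h1 : -(π - τ / 2) < θ)
    (h2 : θ ≤ π - τ) : farLift τ θ = 0 := by
  obtain ⟨-, h3, h4⟩ := farLift_params hτ hτ'
  unfold farLift
  exact gompfLift_eq_zero h3 h4 (by linarith) (by linarith)

/-- The far lift vanishes at `0`. [folklore] -/
theorem farLift_zero (hτ : 0 < τ) (hτ' : τ < π / 2) : farLift τ 0 = 0 :=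
  farLift_eq_zero hτ hτ' (by linarith [Real.pi_pos]) (by linarith)

/-- `θ - farLift τ θ` is `2π`-periodic. [folklore] -/
theorem sub_farLift_periodic (τ θ : ℝ) : θ + 2 * π - farLift τ (θ + 2 * π) = θ - farLift τ θ := by
  rw [farLift_add_two_pi]; ring

end Lift

/-! ### The Dehn twist `δ`, its support `S`, and the straight-line diffeotopy `id ⇝ Δ ∘ δ⁻¹` -/

section Dehn

variable {τ : ℝ} (hτ : 0 < τ) (hτ' : τ < π / 2)

/-- **Gompf's Dehn twist `δ` with the far lift**: `(z₁, z₂, z₃) ↦ (z₁ e^{-i f(arg z₂)}, z₂,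
z₃ e^{i f(arg z₂)})`, `f = farLift τ` — a twist along the tori `{z₂ = const}` in the direction
`e₃ - e₁`, supported in the collar `{|arg z₂| ≥ π - τ}` (Gompf 2010, Thm 2.1/§3: "a Dehn twist `δ`
along the torus spanned by the first and third coordinate axes … isotopic to the linear
diffeomorphism `Δ`"). [cite: GompfAGT2010, §2 (definition of δ after Thm 2.1) and §3] -/
def farDehn : ThreeTorus ≃ₘ⟮𝓣, 𝓣⟯ ThreeTorus :=
  torusDehnTwist (farLift τ) 1 (contDiff_farLift hτ hτ') (farLift_periodic τ)

/-- The underlying map of `δ`. [folklore] -/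
theorem coe_farDehn : ⇑(farDehn hτ hτ') = torusTwist (circleMapOfLift (farLift τ)) := rfl

/-- The underlying map of `δ⁻¹`. [folklore] -/
theorem coe_farDehn_symm :
    ⇑(farDehn hτ hτ').symm = torusTwist fun w ↦ (circleMapOfLift (farLift τ) w)⁻¹ := rfl

/-- **The support collar `S = {|arg z₂| ≥ π - τ}`** of `δ` (written as `re z₂ ≤ cos (π - τ)`, a
closed condition). [cite: GompfAGT2010, §2 (a collar I × S¹ × S¹ of T supporting δ)] -/
def farSupport (τ : ℝ) : Set ThreeTorus := {z | ((z.2.1 : Circle) : ℂ).re ≤ Real.cos (π - τ)}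

omit hτ hτ' in
/-- The support collar is closed. [folklore] -/
theorem isClosed_farSupport (τ : ℝ) : IsClosed (farSupport τ) :=
  isClosed_le ((Complex.continuous_re.comp continuous_subtype_val).comp
    (continuous_fst.comp continuous_snd)) continuous_const

omit hτ hτ' in
/-- The support collar is compact. [folklore] -/
theorem isCompact_farSupport (τ : ℝ) : IsCompact (farSupport τ) :=
  (isClosed_farSupport τ).isCompact

include hτ hτ' in
/-- The base point is not in the support collar. [folklore] -/
theorem one_not_mem_farSupport : (1 : ThreeTorus) ∉ farSupport τ := by
  intro h
  simp only [farSupport, mem_setOf_eq] at h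
  have h1 : ((1 : ThreeTorus).2.1 : ℂ).re = 1 := by simp
  rw [h1, Real.cos_pi_sub] at h
  have := Real.cos_nonneg_of_neg_pi_div_two_le_of_le (x := τ) (by linarith) (by linarith)
  linarith

omit hτ hτ' in
/-- For a unit complex number, `cos (arg w) = re w`. [folklore] -/
theorem cos_arg_circle (w : Circle) : Real.cos (Complex.arg (w : ℂ)) = (w : ℂ).re := by
  rw [Complex.cos_arg (Circle.coe_ne_zero w), Circle.norm_coe, div_one]

include hτ hτ' in
/-- **Off the collar, `|arg z₂| < π - τ`.** [folklore] -/
theorem abs_arg_lt_of_not_mem {z : ThreeTorus} (hz : z ∉ farSupport τ) :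
    |Complex.arg ((z.2.1 : Circle) : ℂ)| < π - τ := by
  simp only [farSupport, mem_setOf_eq, not_le] at hz
  rw [← cos_arg_circle, ← Real.cos_abs (Complex.arg _)] at hz
  by_contra h
  push Not at h
  have := Real.cos_le_cos_of_nonneg_of_le_pi (by linarith) ((abs_le.2
    ⟨by linarith [Complex.neg_pi_lt_arg ((z.2.1 : Circle) : ℂ)], Complex.arg_le_pi _⟩)) h
  linarith

include hτ hτ' in
/-- **Off the collar the lift vanishes at `arg z₂`.** [folklore] -/
theorem farLift_arg_eq_zero {z : ThreeTorus} (hz : z ∉ farSupport τ) :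
    farLift τ (Complex.arg ((z.2.1 : Circle) : ℂ)) = 0 := by
  have h := abs_lt.1 (abs_arg_lt_of_not_mem hτ hτ' hz)
  exact farLift_eq_zero hτ hτ' (by linarith) h.2.le

/-- **`δ` is the identity off the collar `S`.** [cite: GompfAGT2010, §2 (δ is supported in a collar of T, away from p)] -/
theorem farDehn_eq_self {z : ThreeTorus} (hz : z ∉ farSupport τ) : farDehn hτ hτ' z = z := by
  rw [coe_farDehn]
  refine torusTwist_eq_self_of ?_
  rw [circleMapOfLift, farLift_arg_eq_zero hτ hτ' hz, Circle.exp_zero]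

/-- `δ` fixes the base point. [folklore] -/
theorem farDehn_apply_one : farDehn hτ hτ' 1 = 1 :=
  farDehn_eq_self hτ hτ' (one_not_mem_farSupport hτ hτ')

include hτ in
/-- **Points with small second exponential coordinate are off the collar**: if `|v₁| < π - τ`
then `expT v ∉ S`. [folklore] -/
theorem expT_not_mem_farSupport {v : 𝔼 3} (hv : |v 1| < π - τ) : expT v ∉ farSupport τ := by
  simp only [farSupport, mem_setOf_eq, not_le]
  have h1 : ((expT v).2.1 : ℂ).re = Real.cos (v 1) := by
    show ((Circle.exp (v 1) : Circle) : ℂ).re = Real.cos (v 1)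
    rw [Circle.coe_exp, Complex.exp_ofReal_mul_I_re]
  rw [h1, ← Real.cos_abs (v 1)]
  exact Real.cos_lt_cos_of_nonneg_of_le_pi (abs_nonneg _) (by linarith) hv

/-- **The straight-line diffeotopy `D_t` from `id` to `Δ ∘ δ⁻¹`**: the twists by the circle maps
with lifts `t (θ - f θ)` (Gompf §3: "`δ` is isotopic to the linear diffeomorphism `Δ`", by the
straight-line homotopy of lifts; here between `id` and `Δ ∘ δ⁻¹`). [cite: GompfAGT2010, §3 (δ is isotopic to Δ)] -/
def farDiffeotopy : Diffeotopy 𝓣 ThreeTorus :=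
  torusTwistDiffeotopy (fun θ ↦ θ - farLift τ θ) (contDiff_id.sub (contDiff_farLift hτ hτ'))
    (sub_farLift_periodic τ)

/-- The stages of the straight-line diffeotopy. [folklore] -/
theorem farDiffeotopy_toFun (t : ℝ) :
    (farDiffeotopy hτ hτ').toFun t = torusTwist (circleMapOfLift fun θ ↦ t * (θ - farLift τ θ)) :=
  torusTwistDiffeotopy_toFun _ _ _ t

/-- The stages of the diffeotopy fix the base point. [folklore] -/
theorem farDiffeotopy_apply_one (t : ℝ) : (farDiffeotopy hτ hτ').toFun t 1 = 1 := by
  rw [farDiffeotopy_toFun]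
  exact torusTwist_apply_one (circleMapOfLift_one (by simp [farLift_zero hτ hτ']))

/-- **The diffeotopy is linear in exponential coordinates near the section circle**: for
`|v₁| < π - τ`, `D_t (expT v) = expT (Δ_t v)`. [cite: GompfAGT2010, §4 ¶3 (the isotopy can be taken to be linear … its derivative is the linear straightening of Δ^k)] -/
theorem farDiffeotopy_expT (t : ℝ) {v : 𝔼 3} (hv : |v 1| < π - τ) :
    (farDiffeotopy hτ hτ').toFun t (expT v) = expT (mulVecE (gompfDeltaReal t) v) := by
  have h := abs_lt.1 hv
  have hmem : v 1 ∈ Ioc (-π) π := ⟨by linarith, by linarith⟩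
  rw [farDiffeotopy_toFun]
  refine torusTwist_expT_of ?_
  rw [circleMapOfLift_exp_of_mem _ hmem, farLift_eq_zero hτ hτ' (by linarith) h.2.le, sub_zero]

/-- **`δ` is the identity in exponential coordinates near the section circle**: for
`|v₁| < π - τ`, `δ (expT v) = expT v`. [folklore] -/
theorem farDehn_expT {v : 𝔼 3} (hv : |v 1| < π - τ) : farDehn hτ hτ' (expT v) = expT v :=
  farDehn_eq_self hτ hτ' (expT_not_mem_farSupport hτ hv)

/-- `δ⁻¹` is the identity in exponential coordinates near the section circle. [folklore] -/
theorem farDehn_symm_expT {v : 𝔼 3} (hv : |v 1| < π - τ) : (farDehn hτ hτ').symm (expT v) = expT v := by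
  conv_lhs => rw [← farDehn_expT hτ hτ' hv]
  exact Diffeomorph.symm_apply_apply _ _

/-- **The end of the diffeotopy is `Δ ∘ δ⁻¹`**, pointwise: `D_1 z = torusTwist (w ↦ w (F w)⁻¹) z`
with `F` the circle map of `δ`. [cite: GompfAGT2010, §3 (δ is isotopic to Δ)] -/
theorem farDiffeotopy_one_apply (z : ThreeTorus) :
    (farDiffeotopy hτ hτ').toFun 1 z =
      torusTwist (fun w ↦ w * (circleMapOfLift (farLift τ) w)⁻¹) z := by
  rw [farDiffeotopy_toFun]
  congr 1
  funext w
  rw [circleMapOfLift, circleMapOfLift, one_mul, Circle.exp_sub, div_eq_mul_inv, Circle.exp_arg]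

end Dehn

/-! ### The framing path `β₁ = Δ_{μ(·/2)} β` of `Δ B` -/

section Path

variable {B : Matrix.SpecialLinearGroup (Fin 3) ℤ} (β : SmoothMatrixPath (slRealMatrix B))

/-- **The framing path `β₁(u) = Δ_{μ(u/2)} β(u)` of `Δ B`**: the Gompf tube of `B` framed by `β`,
read through the reparametrisation by `D_{μ}`, is the Gompf tube of `Δ B` framed by `β₁` — Gompf
§4 ¶3: the isotopy from `δ` to `Δ` changes "the straightening to `τ·σ` (for the linear `τ`)";
`[β₁] = [β.deltaLeft 1]`. [cite: GompfAGT2010, §4 ¶3 (the isotopy changes the straightening to τ·σ)] -/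
def deltaTwistPath : SmoothMatrixPath (slRealMatrix (gompfDelta ^ (1 : ℤ) * B)) where
  toFun u := gompfDeltaReal (startProfile (u / 2)) * β.toFun u
  inv u := β.inv u * gompfDeltaReal (-startProfile (u / 2))
  contDiff_apply := SmoothMatrixPath.contDiff_mul_apply
    (contDiff_gompfDeltaReal_apply (contDiff_startProfile.comp (contDiff_id.div_const 2)))
    β.contDiff_apply
  contDiff_inv_apply := SmoothMatrixPath.contDiff_mul_apply β.contDiff_inv_apply
    (contDiff_gompfDeltaReal_apply (contDiff_startProfile.comp (contDiff_id.div_const 2)).neg)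
  mul_inv u := by
    rw [Matrix.mul_assoc, ← Matrix.mul_assoc (β.toFun u), β.mul_inv, Matrix.one_mul,
      gompfDeltaReal_mul, add_neg_cancel, gompfDeltaReal_zero]
  inv_mul u := by
    rw [Matrix.mul_assoc, ← Matrix.mul_assoc (gompfDeltaReal _), gompfDeltaReal_mul,
      neg_add_cancel, gompfDeltaReal_zero, Matrix.one_mul, β.inv_mul]
  eq_one u hu := by
    rw [startProfile_of_le (by linarith), gompfDeltaReal_zero, Matrix.one_mul, β.eq_one u hu]
  eq_self u hu := by
    rw [startProfile_of_ge (by linarith), β.eq_self u hu, slRealMatrix_mul,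
      slRealMatrix_gompfDelta_zpow_one]

/-- Values of `β₁`. [folklore] -/
@[simp] theorem deltaTwistPath_toFun (u : ℝ) :
    (deltaTwistPath β).toFun u = gompfDeltaReal (startProfile (u / 2)) * β.toFun u := rfl

/-- Values of `β₁` at `2 s`: `β₁(2s) = Δ_{μ s} β(2s)`. [folklore] -/
theorem deltaTwistPath_toFun_two_mul (s : ℝ) :
    (deltaTwistPath β).toFun (2 * s) = gompfDeltaReal (startProfile s) * β.toFun (2 * s) := by
  rw [deltaTwistPath_toFun, mul_div_cancel_left₀ s two_ne_zero]

end Path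

/-! ### `CSTorus (Δ B)` with reparametrised cylinders is a mapping torus of `δ ∘ B` -/

section Structure

variable (B : Matrix.SpecialLinearGroup (Fin 3) ℤ) {τ : ℝ} (hτ : 0 < τ) (hτ' : τ < π / 2)

/-- Shorthand: `Δ B` as an element of `SL(3, ℤ)` (with `Δ = gompfDelta ^ 1`, the form used by
`gompf2010_framedTwist_of_one`). [folklore] -/
abbrev deltaMul : Matrix.SpecialLinearGroup (Fin 3) ℤ := gompfDelta ^ (1 : ℤ) * B

/-- **The reparametrised first cylinder of `CSTorus (Δ B)`**: `inl ∘ fibreTwistOne D`. [folklore] -/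
def dehnCylA : ThreeTorus × ↥mappingTorusPieceOne → CSTorus (deltaMul B) :=
  (csGlueData (deltaMul B)).inl ∘ fibreTwistOne (farDiffeotopy hτ hτ')

/-- **The reparametrised second cylinder of `CSTorus (Δ B)`**: `inr ∘ fibreTwistTwo (Δ B) D`. [folklore] -/
def dehnCylB : ThreeTorus × ↥mappingTorusPieceTwo → CSTorus (deltaMul B) :=
  (csGlueData (deltaMul B)).inr ∘ fibreTwistTwo (torusDiffeomorph (deltaMul B)) (farDiffeotopy hτ hτ')

/-- Values of the first cylinder embedding (definitional). [folklore] -/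
theorem dehnCylA_apply (a : ThreeTorus × ↥mappingTorusPieceOne) :
    dehnCylA B hτ hτ' a = (csGlueData (deltaMul B)).inl (fibreTwistOne (farDiffeotopy hτ hτ') a) := rfl

/-- Values of the second cylinder embedding (definitional). [folklore] -/
theorem dehnCylB_apply (b : ThreeTorus × ↥mappingTorusPieceTwo) :
    dehnCylB B hτ hτ' b = (csGlueData (deltaMul B)).inr
      (fibreTwistTwo (torusDiffeomorph (deltaMul B)) (farDiffeotopy hτ hτ') b) := rfl

/-- **`D_1 = (Δ B) ∘ (δ ∘ B)⁻¹ = Δ ∘ δ⁻¹`**: the end of the straight-line diffeotopy realises the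
monodromy `δ ∘ B` on `CSTorus (Δ B)` (hypothesis `hD1` of `IsOpenGluingWith.fibreTwist_of_eq`). [cite: GompfAGT2010, §3 (δ is isotopic to Δ)] -/
theorem farDiffeotopy_one_eq (x : ThreeTorus) :
    (farDiffeotopy hτ hτ').toFun 1 x =
      torusDiffeomorph (deltaMul B) (((torusDiffeomorph B).trans (farDehn hτ hτ')).symm x) := by
  have h1 : ((torusDiffeomorph B).trans (farDehn hτ hτ')).symm x =
      torusMap ((B⁻¹ : Matrix.SpecialLinearGroup (Fin 3) ℤ) : Matrix (Fin 3) (Fin 3) ℤ)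
        ((farDehn hτ hτ').symm x) := rfl
  rw [h1, coe_torusDiffeomorph, ← Function.comp_apply (f := torusMap _) (g := torusMap _),
    ← torusMap_mul, ← Matrix.SpecialLinearGroup.coe_mul, mul_inv_cancel_right,
    ← coe_torusDiffeomorph, coe_torusDiffeomorph_gompfDelta_zpow, coe_farDehn_symm,
    torusTwist_torusTwist, farDiffeotopy_one_apply]
  congr 1
  funext w
  rw [zpow_one]

/-- **`CSTorus (Δ B)`, with its cylinders reparametrised by the straight-line diffeotopy, is a
mapping torus of `δ ∘ B`** (an open gluing along `mappingTorusRel (δ ∘ B)`; Gompf §4 ¶3: "Our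
isotopy from `δᵏ` to `Δᵏ` changes the bundle monodromy to `B`", read backwards). [cite: GompfAGT2010, §4 ¶3 (the isotopy from δ^k to Δ^k changes the monodromy to B)] -/
theorem isOpenGluingWith_csTorus_dehn :
    IsOpenGluingWith (ModelWithCorners.prod 𝓣 𝓘(ℝ, ℝ)) (ModelWithCorners.prod 𝓣 𝓘(ℝ, ℝ)) (𝓡 4)
      (mappingTorusRel (⇑(farDehn hτ hτ') ∘ ⇑(torusDiffeomorph B))) (dehnCylA B hτ hτ')
      (dehnCylB B hτ hτ') := by
  have h := (isOpenGluingWith_mappingTorusGlued (torusDiffeomorph (deltaMul B))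
    linTorusModel).fibreTwist_of_eq (torusDiffeomorph (deltaMul B)) (farDiffeotopy hτ hτ')
    ((torusDiffeomorph B).trans (farDehn hτ hτ')) fun x ↦ farDiffeotopy_one_eq B hτ hτ' x
  rwa [Diffeomorph.coe_trans] at h

/-- The second cylinder embedding at a point `(y, t)` near the section circle, unfolded:
`(Δ B) (D_{μ(t-1)} ((Δ B)⁻¹ (D_1 y)))`. [folklore] -/
theorem fibreTwistTwo_deltaMul_fst (b : ThreeTorus × ↥mappingTorusPieceTwo) :
    (fibreTwistTwo (torusDiffeomorph (deltaMul B)) (farDiffeotopy hτ hτ') b).1 =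
      torusMap ((deltaMul B : Matrix.SpecialLinearGroup (Fin 3) ℤ) : Matrix (Fin 3) (Fin 3) ℤ)
        ((farDiffeotopy hτ hτ').toFun (startProfile (b.2 - 1))
          (torusMap (((deltaMul B)⁻¹ : Matrix.SpecialLinearGroup (Fin 3) ℤ) :
            Matrix (Fin 3) (Fin 3) ℤ) ((farDiffeotopy hτ hτ').toFun 1 b.1))) := rfl

/-- The cylinder embeddings are based: the section `{1} × (1/2, 3/2)` goes to itself under the
second twist. [folklore] -/
theorem fibreTwistTwo_deltaMul_one (t : ↥mappingTorusPieceTwo) :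
    fibreTwistTwo (torusDiffeomorph (deltaMul B)) (farDiffeotopy hτ hτ') (1, t) = (1, t) := by
  rw [fibreTwistTwo_apply]
  refine Prod.ext ?_ rfl
  dsimp only
  rw [farDiffeotopy_apply_one,
    (torusDiffeomorph (deltaMul B)).symm_apply_eq_self_of_apply_eq_self
      (torusDiffeomorph_apply_one _), farDiffeotopy_apply_one, torusDiffeomorph_apply_one]

/-- Conversely, if the second twist sends `(y, t)` into the section then `y = 1`. [folklore] -/
theorem eq_one_of_fibreTwistTwo_deltaMul_fst_eq_one {b : ThreeTorus × ↥mappingTorusPieceTwo}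
    (h : (fibreTwistTwo (torusDiffeomorph (deltaMul B)) (farDiffeotopy hτ hτ') b).1 = 1) :
    b.1 = 1 := by
  have h1 := fibreTwistTwo_deltaMul_one B hτ hτ' b.2
  have h2 : fibreTwistTwo (torusDiffeomorph (deltaMul B)) (farDiffeotopy hτ hτ') b =
      fibreTwistTwo (torusDiffeomorph (deltaMul B)) (farDiffeotopy hτ hτ') (1, b.2) := by
    rw [h1]
    exact Prod.ext h rfl
  exact congrArg Prod.fst
    ((fibreTwistTwo (torusDiffeomorph (deltaMul B)) (farDiffeotopy hτ hτ')).injective h2)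

end Structure

/-! ### The Gompf tube of `B` is thin: bounds on its exponential coordinates -/

section Thin

variable (B : Matrix.SpecialLinearGroup (Fin 3) ℤ) (β : SmoothMatrixPath (slRealMatrix B))

/-- `twistBound ≥ 3`. [folklore] -/
theorem three_le_twistBound : 3 ≤ twistBound B β := by
  have h1 := entryBound_nonneg (slRealMatrix B)
  have h2 := β.bound_nonneg
  rw [twistBound]
  nlinarith

/-- **The radius of the Gompf tube is at most `π/10`** (so `< π/2`). [folklore] -/
theorem twistRadius_lt_pi_div_two : twistRadius B β < π / 2 := by
  have hK := three_le_twistBound B β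
  have hπ := Real.pi_pos
  rw [twistRadius, div_lt_div_iff₀ (by linarith) two_pos]
  nlinarith

/-- `3 K ε = π - ε` for `K = twistBound`, `ε = twistRadius`. [folklore] -/
theorem three_mul_twistBound_mul_twistRadius :
    3 * twistBound B β * twistRadius B β = π - twistRadius B β := by
  have hK := three_le_twistBound B β
  rw [twistRadius]
  field_simp
  ring

/-- **The exponential coordinates of the tube fibres are smaller than `π - ε`**: for a matrix `M`
with entries bounded by `twistBound`, `|(M • shrink w) j| < π - ε`. [folklore] -/
theorem abs_mulVecE_shrink_lt {M : Matrix (Fin 3) (Fin 3) ℝ} (hM : ∀ i j, |M i j| ≤ twistBound B β)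
    (w : 𝔼 3) (j : Fin 3) :
    |mulVecE M ((twistA B β).shrink w) j| < π - twistRadius B β := by
  have hK := three_le_twistBound B β
  have h1 : |mulVecE M ((twistA B β).shrink w) j| ≤
      3 * twistBound B β * ‖(twistA B β).shrink w‖ := by
    simpa using abs_mulVecE_apply_le hM ((twistA B β).shrink w) j
  have h2 : ‖(twistA B β).shrink w‖ < twistRadius B β := (twistA B β).norm_shrink_lt w
  have h3 : 3 * twistBound B β * ‖(twistA B β).shrink w‖ <
      3 * twistBound B β * twistRadius B β :=
    mul_lt_mul_of_pos_left h2 (by linarith)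
  rw [three_mul_twistBound_mul_twistRadius] at h3
  linarith

/-- The fibres over the first cylinder: `|(β(2s) • shrink w) j| < π - ε`. [folklore] -/
theorem abs_twistA_lt (s : ℝ) (w : 𝔼 3) (j : Fin 3) :
    |mulVecE (β.toFun (2 * s)) ((twistA B β).shrink w) j| < π - twistRadius B β :=
  abs_mulVecE_shrink_lt B β (abs_path_le_twistBound B β _) w j

/-- The fibres over the second cylinder: `|(B β(2(t-1)) • shrink w) j| < π - ε`. [folklore] -/
theorem abs_twistB_lt (t : ℝ) (w : 𝔼 3) (j : Fin 3) :
    |mulVecE (slRealMatrix B * β.toFun (2 * (t - 1))) ((twistA B β).shrink w) j| <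
      π - twistRadius B β :=
  abs_mulVecE_shrink_lt B β (abs_mul_path_le_twistBound B β _) w j

/-- The twisted exponentials of the Gompf tube, unfolded (definitional). [folklore] -/
theorem texp_twistA_eq (s : ℝ) (w : 𝔼 3) :
    (twistA B β).texp s w = expT (mulVecE (β.toFun (2 * s)) ((twistA B β).shrink w)) := rfl

/-- The twisted exponentials over the second cylinder, unfolded (definitional). [folklore] -/
theorem texp_twistB_eq (t : ℝ) (w : 𝔼 3) :
    (twistB B β).texp t w =
      expT (mulVecE (slRealMatrix B * β.toFun (2 * (t - 1))) ((twistA B β).shrink w)) := rfl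

end Thin

/-! ### The sliver data of `(B, β)` and the transported Gompf tube -/

section Transport

variable (B : Matrix.SpecialLinearGroup (Fin 3) ℤ) (β : SmoothMatrixPath (slRealMatrix B))

/-- **The Dehn twist `δ` for `(B, β)`**: the far Dehn twist with margin the tube radius `ε`
(so that `δ` is the identity on the Gompf tube of `β`). [cite: GompfAGT2010, §2 (definition of δ after Thm 2.1) and §3] -/
def rowDehn : ThreeTorus ≃ₘ⟮𝓣, 𝓣⟯ ThreeTorus :=
  farDehn (twistRadius_pos B β) (twistRadius_lt_pi_div_two B β)

/-- **The support collar `S` of `δ`.** [cite: GompfAGT2010, §2 (a collar I × S¹ × S¹ of T supporting δ)] -/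
def rowSupport : Set ThreeTorus := farSupport (twistRadius B β)

/-- The reparametrised first cylinder of `CSTorus (Δ B)` for `(B, β)`. [folklore] -/
def rowCylA : ThreeTorus × ↥mappingTorusPieceOne → CSTorus (deltaMul B) :=
  dehnCylA B (twistRadius_pos B β) (twistRadius_lt_pi_div_two B β)

/-- The reparametrised second cylinder of `CSTorus (Δ B)` for `(B, β)`. [folklore] -/
def rowCylB : ThreeTorus × ↥mappingTorusPieceTwo → CSTorus (deltaMul B) :=
  dehnCylB B (twistRadius_pos B β) (twistRadius_lt_pi_div_two B β)

/-- `CSTorus B` is a mapping torus of `B` (canonical witnesses). [folklore] -/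
theorem isOpenGluingWith_csTorus :
    IsOpenGluingWith (ModelWithCorners.prod 𝓣 𝓘(ℝ, ℝ)) (ModelWithCorners.prod 𝓣 𝓘(ℝ, ℝ)) (𝓡 4)
      (mappingTorusRel ⇑(torusDiffeomorph B)) (csGlueData B).inl (csGlueData B).inr :=
  isOpenGluingWith_mappingTorusGlued (torusDiffeomorph B) linTorusModel

/-- `CSTorus (Δ B)` with the cylinders of `(B, β)` is a mapping torus of `δ ∘ B`. [cite: GompfAGT2010, §4 ¶3 (the isotopy from δ^k to Δ^k changes the monodromy to B)] -/
theorem isOpenGluingWith_csTorus_rowDehn :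
    IsOpenGluingWith (ModelWithCorners.prod 𝓣 𝓘(ℝ, ℝ)) (ModelWithCorners.prod 𝓣 𝓘(ℝ, ℝ)) (𝓡 4)
      (mappingTorusRel (⇑(rowDehn B β) ∘ ⇑(torusDiffeomorph B))) (rowCylA B β) (rowCylB B β) :=
  isOpenGluingWith_csTorus_dehn B _ _

/-- The sliver image in `CSTorus B` is closed. [folklore] -/
theorem isClosed_image_rowSliver :
    IsClosed ((csGlueData B).inr '' fibreSliver (rowSupport B β)) :=
  isClosed_image_fibreSliver (csGlueData B).continuous_inr (isCompact_farSupport _)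

/-- The sliver image in `CSTorus (Δ B)` is closed. [folklore] -/
theorem isClosed_image_rowSliver' : IsClosed (rowCylB B β '' fibreSliver (rowSupport B β)) :=
  isClosed_image_fibreSliver ((csGlueData (deltaMul B)).continuous_inr.comp
    (fibreTwistTwo _ _).continuous) (isCompact_farSupport _)

/-- **The complement `U` of the sliver in `CSTorus B`.** [cite: GompfAGT2010, Thm 2.1 (proof, last paragraph)] -/
def rowOpens : TopologicalSpace.Opens (CSTorus B) :=
  sliverCompl (csGlueData B).inr (rowSupport B β) (isClosed_image_rowSliver B β)

/-- **The complement `U'` of the sliver in `CSTorus (Δ B)`.** [folklore] -/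
def rowOpens' : TopologicalSpace.Opens (CSTorus (deltaMul B)) :=
  sliverCompl (rowCylB B β) (rowSupport B β) (isClosed_image_rowSliver' B β)

/-- **The Gompf tube of `β` misses the sliver** (its fibres have `|arg z₂| < π - ε`, the collar
`S` has `|arg z₂| ≥ π - ε`; and no point of the tube over the first cylinder is glued to the
level `t = 1`). [folklore] -/
theorem sectionCircleNbhd_mem_rowOpens (q : (𝕊 1) × (𝔼 3)) :
    (sectionCircleNbhd B β).toFun q ∈ rowOpens B β := by
  rw [rowOpens, mem_sliverCompl_iff]
  rintro ⟨b, hb, hq⟩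
  obtain ⟨u, w⟩ := q
  change (csGlueData B).inr b = secNbhdFun B β (u, w) at hq
  by_cases hu : u = ptB
  · have hA : u ≠ ptA := hu ▸ ptA_ne_ptB.symm
    rw [secNbhdFun_of_ne B β (show ((u, w) : (𝕊 1) × 𝔼 3).1 ≠ ptA from hA), eq_comm,
      mappingTorusGlued_inl_eq_inr_iff] at hq
    exact not_mappingTorusRel_of_coe_snd_eq_one _ _ hb.2 hq
  · rw [secNbhdFun_of_ne_ptB B β (show ((u, w) : (𝕊 1) × 𝔼 3).1 ≠ ptB from hu),
      TubeTwist.tubeB_apply] at hq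
    have hb1 : b.1 = (twistB B β).texp (angBPt u) w :=
      congrArg Prod.fst ((csGlueData B).inr_injective hq)
    have hS : b.1 ∈ rowSupport B β := hb.1
    rw [hb1, texp_twistB_eq] at hS
    exact expT_not_mem_farSupport (twistRadius_pos B β) (abs_twistB_lt B β _ w 1) hS

/-- A sliver twist by a map fixing `b.1` fixes `b`. [folklore] -/
theorem sliverTwist_eq_self_of_apply {g : ThreeTorus → ThreeTorus} {b : ThreeTorus × ↥mappingTorusPieceTwo}
    (h : g b.1 = b.1) : sliverTwist g b = b := by
  unfold sliverTwist
  split_ifs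
  · exact Prod.ext h rfl
  · rfl

variable (Θ : ↥(rowOpens B β) ≃ₘ⟮𝓡 4, 𝓡 4⟯ ↥(rowOpens' B β))
  (hΘA : ∀ (x : ↥(rowOpens B β)) (a : ThreeTorus × ↥mappingTorusPieceOne),
    (x : CSTorus B) = (csGlueData B).inl a → (Θ x : CSTorus (deltaMul B)) = rowCylA B β a)
  (hΘB : ∀ (x : ↥(rowOpens B β)) (b : ThreeTorus × ↥mappingTorusPieceTwo),
    (x : CSTorus B) = (csGlueData B).inr b →
      (Θ x : CSTorus (deltaMul B)) = rowCylB B β (sliverTwist (rowDehn B β) b))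

include hΘA in
/-- **The transported Gompf tube over the first cylinder is a Gompf tube of `Δ B` framed by
`β₁`**: off `ptA`, `Θ (ν_β (u, w)) = inl (expT (β₁(2s) • shrink_ε w), s)`, `s = angA u`
(`D_{μ s}` is linear on the thin tube). [cite: GompfAGT2010, §4 ¶3 (the isotopy changes the straightening to τ·σ)] -/
theorem transport_secNbhd_of_ne_ptA {u : 𝕊 1} (hu : u ≠ ptA) (w : 𝔼 3) :
    ((Θ ⟨(sectionCircleNbhd B β).toFun (u, w), sectionCircleNbhd_mem_rowOpens B β (u, w)⟩ :
        ↥(rowOpens' B β)) : CSTorus (deltaMul B)) =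
      (csGlueData (deltaMul B)).inl
        (expT (mulVecE ((deltaTwistPath β).toFun (2 * angAPt u)) ((twistA B β).shrink w)),
          angAPt u) := by
  have hq : (sectionCircleNbhd B β).toFun (u, w) = (csGlueData B).inl ((twistA B β).tubeA (u, w)) :=
    secNbhdFun_of_ne B β (show ((u, w) : (𝕊 1) × 𝔼 3).1 ≠ ptA from hu)
  rw [hΘA _ _ hq, rowCylA, dehnCylA_apply, TubeTwist.tubeA_apply, fibreTwistOne_apply]
  dsimp only
  rw [texp_twistA_eq, farDiffeotopy_expT _ _ _ (abs_twistA_lt B β _ w 1), mulVecE_mulVecE,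
    deltaTwistPath_toFun_two_mul]

/-- `(Δ B)⁻¹ Δ B = 1` on real matrices. [folklore] -/
theorem slRealMatrix_deltaMul_inv_mul_gompfDeltaReal_mul :
    slRealMatrix (deltaMul B)⁻¹ * gompfDeltaReal 1 * slRealMatrix B = 1 := by
  rw [deltaMul, mul_inv_rev, slRealMatrix_mul, Matrix.mul_assoc (slRealMatrix B⁻¹),
    ← slRealMatrix_gompfDelta_zpow_one, slRealMatrix_inv_mul, Matrix.mul_one, slRealMatrix_inv_mul]

include hΘB in
/-- **The transported Gompf tube over the second cylinder is a Gompf tube of `Δ B` framed by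
`β₁`**: off `ptB`, `Θ (ν_β (u, w)) = inr (expT ((Δ B) β₁(2(t-1)) • shrink_ε w), t)`, `t = angB u`
(`δ` is the identity and `D` is linear on the thin tube). [cite: GompfAGT2010, §4 ¶3 (the isotopy changes the straightening to τ·σ)] -/
theorem transport_secNbhd_of_ne_ptB {u : 𝕊 1} (hu : u ≠ ptB) (w : 𝔼 3) :
    ((Θ ⟨(sectionCircleNbhd B β).toFun (u, w), sectionCircleNbhd_mem_rowOpens B β (u, w)⟩ :
        ↥(rowOpens' B β)) : CSTorus (deltaMul B)) =
      (csGlueData (deltaMul B)).inr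
        (expT (mulVecE (slRealMatrix (deltaMul B) * (deltaTwistPath β).toFun (2 * (angBPt u - 1)))
          ((twistA B β).shrink w)), angBPt u) := by
  have hq : (sectionCircleNbhd B β).toFun (u, w) = (csGlueData B).inr ((twistB B β).tubeB (u, w)) :=
    secNbhdFun_of_ne_ptB B β (show ((u, w) : (𝕊 1) × 𝔼 3).1 ≠ ptB from hu)
  have hε := twistRadius_pos B β
  have hε' := twistRadius_lt_pi_div_two B β
  -- `δ` fixes the tube point, so the sliver twist does too
  have hfix : sliverTwist (rowDehn B β) ((twistB B β).tubeB (u, w)) = (twistB B β).tubeB (u, w) := by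
    refine sliverTwist_eq_self_of_apply ?_
    rw [TubeTwist.tubeB_apply]
    dsimp only
    rw [texp_twistB_eq, rowDehn, farDehn_expT hε hε' (abs_twistB_lt B β _ w 1)]
  rw [hΘB _ _ hq, hfix, rowCylB, dehnCylB_apply]
  congr 1
  refine Prod.ext ?_ rfl
  rw [fibreTwistTwo_deltaMul_fst, TubeTwist.tubeB_apply]
  dsimp only
  rw [texp_twistB_eq, farDiffeotopy_expT hε hε' 1 (abs_twistB_lt B β _ w 1), mulVecE_mulVecE,
    torusMap_expT', mulVecE_mulVecE, ← Matrix.mul_assoc, ← Matrix.mul_assoc,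
    slRealMatrix_deltaMul_inv_mul_gompfDeltaReal_mul, Matrix.one_mul,
    farDiffeotopy_expT hε hε' _ (abs_twistA_lt B β _ w 1), mulVecE_mulVecE, torusMap_expT',
    mulVecE_mulVecE, ← Matrix.mul_assoc, deltaTwistPath_toFun_two_mul, Matrix.mul_assoc]

include hΘA hΘB in
/-- **The transported section circle is the section circle of `CSTorus (Δ B)`** (all twists are
based). [folklore] -/
theorem transport_sectionCircle (u : 𝕊 1) :
    ((Θ ⟨(sectionCircleNbhd B β).toFun (u, 0), sectionCircleNbhd_mem_rowOpens B β (u, 0)⟩ :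
        ↥(rowOpens' B β)) : CSTorus (deltaMul B)) =
      sectionCircle (deltaMul B) (deltaTwistPath β) u := by
  by_cases hu : u = ptA
  · subst hu
    rw [transport_secNbhd_of_ne_ptB B β Θ hΘB ptA_ne_ptB, TubeTwist.shrink_zero, mulVecE_zero,
      expT_zero, sectionCircle_of_ne_ptB _ _ ptA_ne_ptB]
  · rw [transport_secNbhd_of_ne_ptA B β Θ hΘA hu, TubeTwist.shrink_zero, mulVecE_zero, expT_zero,
      sectionCircle_of_ne _ _ hu]

/-- **The transported tube `ν' = Θ ∘ ν_β`** as a tubular neighbourhood of the section circle of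
`CSTorus (Δ B)` framed by `β₁` (same map as `CircleNbhd.transportOpens`, re-indexed by the section
circle). [folklore] -/
def transportedTube : CircleNbhd (𝓡 4) (sectionCircle (deltaMul B) (deltaTwistPath β)) where
  toFun q := ((Θ ⟨(sectionCircleNbhd B β).toFun q, sectionCircleNbhd_mem_rowOpens B β q⟩ :
    ↥(rowOpens' B β)) : CSTorus (deltaMul B))
  isSmoothEmbedding :=
    ((sectionCircleNbhd B β).transportOpens (sectionCircleNbhd_mem_rowOpens B β) Θ).isSmoothEmbedding
  isOpen_range :=
    ((sectionCircleNbhd B β).transportOpens (sectionCircleNbhd_mem_rowOpens B β) Θ).isOpen_range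
  apply_zero u := transport_sectionCircle B β Θ hΘA hΘB u

/-- Values of the transported tube (definitional). [folklore] -/
@[simp] theorem transportedTube_apply (q : (𝕊 1) × 𝔼 3) :
    (transportedTube B β Θ hΘA hΘB).toFun q =
      ((Θ ⟨(sectionCircleNbhd B β).toFun q, sectionCircleNbhd_mem_rowOpens B β q⟩ :
        ↥(rowOpens' B β)) : CSTorus (deltaMul B)) := rfl

/-- **The reparametrised second cylinder meets the section circle of `CSTorus (Δ B)` only over
the base point.** [folklore] -/
theorem rowCylB_mem_range_sectionCircle {b : ThreeTorus × ↥mappingTorusPieceTwo}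
    (hb : rowCylB B β b ∈ range (sectionCircle (deltaMul B) (deltaTwistPath β))) : b.1 = 1 := by
  rw [range_sectionCircle, rowCylB, dehnCylB_apply] at hb
  refine eq_one_of_fibreTwistTwo_deltaMul_fst_eq_one B (twistRadius_pos B β)
    (twistRadius_lt_pi_div_two B β) ?_
  rcases hb with ⟨a, ha, hab⟩ | ⟨b', hb', hbb⟩
  · obtain ⟨ha1, -⟩ := mem_prod.1 ha
    rw [mem_singleton_iff] at ha1
    rcases (mappingTorusGlued_inl_eq_inr_iff _ _ a _).1 hab with ⟨-, h⟩ | ⟨-, h⟩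
    · rw [h, ha1]
    · rw [h, ha1, torusDiffeomorph_apply_one]
  · obtain ⟨hb1, -⟩ := mem_prod.1 hb'
    rw [mem_singleton_iff] at hb1
    rw [← (csGlueData (deltaMul B)).inr_injective hbb, hb1]

/-- The reparametrised second cylinder contains the part of the section circle over the base
point. [folklore] -/
theorem rowCylB_one_mem_range_sectionCircle (t : ↥mappingTorusPieceTwo) :
    rowCylB B β (1, t) ∈ range (sectionCircle (deltaMul B) (deltaTwistPath β)) := by
  rw [range_sectionCircle, rowCylB, dehnCylB_apply, fibreTwistTwo_deltaMul_one]
  exact Or.inr ⟨(1, t), mk_mem_prod rfl (mem_univ _), rfl⟩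

end Transport

/-! ### Gompf tubes with another radius give the same surgery -/

section Rescale

/-- **Fibrewise rescaling of the model tube**: `(u, w) ↦ (u, sh_ε⁻¹ (c • sh_ε w))` on the unit ball,
the identity off `B(0, 7/2)` (`FibreStraightening.tubeFibreDiffeo` with `L = 1`). [cite: GompfStipsiczGSM1999, §5.2] -/
def rescaleTube {ε : ℝ} (hε : 0 < ε) (c : ℝ) : TubeDiffeo where
  toDiffeomorph := (Diffeomorph.refl (𝓡 1) (𝕊 1) ∞).prodCongr
    (tubeFibreDiffeo hε c (1 : 𝔼 3 →L[ℝ] 𝔼 3) (by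
      rw [sub_self, norm_zero]; exact straightenThreshold_pos _))
  radius := 7 / 2
  apply_zero u := by
    rw [Diffeomorph.coe_prodCongr, Prod.map_apply, coe_tubeFibreDiffeo, tubeFibreFun_apply_zero]
    rfl
  eq_self p hp := by
    rw [Diffeomorph.coe_prodCongr, Prod.map_apply, coe_tubeFibreDiffeo,
      tubeFibreFun_of_le_norm hε c 1 hp]
    rfl

/-- The rescaling on the unit ball: `(u, w) ↦ (u, sh_ε⁻¹ (c • sh_ε w))`. [folklore] -/
theorem rescaleTube_apply_of_norm_le {ε : ℝ} (hε : 0 < ε) {c : ℝ} (hc : 0 < c) (hc1 : c ≤ 1)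
    (u : 𝕊 1) {w : 𝔼 3} (hw : ‖w‖ ≤ 1) :
    (rescaleTube hε c).toDiffeomorph (u, w) =
      (u, (OpenPartialHomeomorph.univBall (0 : 𝔼 3) ε).symm
        (c • OpenPartialHomeomorph.univBall (0 : 𝔼 3) ε w)) := by
  have hL : ‖(1 : 𝔼 3 →L[ℝ] 𝔼 3)‖ ≤ 7 / 6 := by
    rw [ContinuousLinearMap.one_def]
    exact ContinuousLinearMap.norm_id_le.trans (by norm_num)
  show Prod.map (Diffeomorph.refl (𝓡 1) (𝕊 1) ∞) (tubeFibreDiffeo hε c (1 : 𝔼 3 →L[ℝ] 𝔼 3) _) (u, w) = _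
  rw [Prod.map_apply, coe_tubeFibreDiffeo, tubeFibreFun_of_norm_le hε hc hc1 hL hw]
  rfl

/-- `sh_ε = (ε / ε₁) • sh_{ε₁}` for the shrinking maps of two radii. [folklore] -/
theorem univBall_eq_smul_univBall {ε ε₁ : ℝ} (hε : 0 < ε) (hε₁ : 0 < ε₁) (w : 𝔼 3) :
    OpenPartialHomeomorph.univBall (0 : 𝔼 3) ε w =
      (ε / ε₁) • OpenPartialHomeomorph.univBall (0 : 𝔼 3) ε₁ w := by
  rw [univBall_zero_eq_smul hε, univBall_zero_eq_smul hε₁, smul_smul (ε / ε₁) ε₁,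
    div_mul_cancel₀ _ hε₁.ne']

/-- `sh_ε (sh_ε⁻¹ v) = v` on the ball of radius `ε`. [folklore] -/
theorem univBall_symm_apply_of_norm_lt {ε : ℝ} (hε : 0 < ε) {v : 𝔼 3} (hv : ‖v‖ < ε) :
    OpenPartialHomeomorph.univBall (0 : 𝔼 3) ε ((OpenPartialHomeomorph.univBall (0 : 𝔼 3) ε).symm v) = v :=
  (OpenPartialHomeomorph.univBall (0 : 𝔼 3) ε).right_inv
    (by rw [OpenPartialHomeomorph.univBall_target _ hε, mem_ball_zero_iff]; exact hv)

variable {A : Matrix.SpecialLinearGroup (Fin 3) ℤ} (γ : SmoothMatrixPath (slRealMatrix A))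

/-- The Gompf tube of `γ`, off `ptA`, in terms of the shrinking map of radius `twistRadius`. [folklore] -/
theorem secNbhdFun_of_ne_ptA_eq {u : 𝕊 1} (hu : u ≠ ptA) (w : 𝔼 3) :
    secNbhdFun A γ (u, w) = (csGlueData A).inl (expT (mulVecE (γ.toFun (2 * angAPt u))
      (OpenPartialHomeomorph.univBall (0 : 𝔼 3) (twistRadius A γ) w)), angAPt u) :=
  secNbhdFun_of_ne A γ (show ((u, w) : (𝕊 1) × 𝔼 3).1 ≠ ptA from hu)

/-- The Gompf tube of `γ`, off `ptB`, in terms of the shrinking map of radius `twistRadius`. [folklore] -/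
theorem secNbhdFun_of_ne_ptB_eq {u : 𝕊 1} (hu : u ≠ ptB) (w : 𝔼 3) :
    secNbhdFun A γ (u, w) = (csGlueData A).inr (expT (mulVecE (slRealMatrix A * γ.toFun (2 * (angBPt u - 1)))
      (OpenPartialHomeomorph.univBall (0 : 𝔼 3) (twistRadius A γ) w)), angBPt u) :=
  secNbhdFun_of_ne_ptB A γ (show ((u, w) : (𝕊 1) × 𝔼 3).1 ≠ ptB from hu)

/-- **A tube given by Gompf's formula with another radius gives the same surgery.** If a tube `ν'`
of the section circle of `CSTorus A` is given, off `ptA` and off `ptB`, by the formulas of the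
Gompf tube of the framing path `γ` but with the shrinking map of some radius `ε > 0`, then
`ν'.Surgered ≅ gompfSphere A γ`: the two tubes agree on the unit ball bundle up to the fibrewise
rescaling by `ε / twistRadius A γ` (or its inverse), which does not change the surgery
(`CircleNbhd.nonempty_diffeomorph_surgered_of_eqOn_twist`). [cite: GompfStipsiczGSM1999, §5.2] -/
theorem nonempty_diffeomorph_gompfSphere_of_gompfForm {ε : ℝ} (hε : 0 < ε)
    (ν' : CircleNbhd (𝓡 4) (sectionCircle A γ))
    (hνA : ∀ u, u ≠ ptA → ∀ w : 𝔼 3, ν'.toFun (u, w) = (csGlueData A).inl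
      (expT (mulVecE (γ.toFun (2 * angAPt u)) (OpenPartialHomeomorph.univBall (0 : 𝔼 3) ε w)),
        angAPt u))
    (hνB : ∀ u, u ≠ ptB → ∀ w : 𝔼 3, ν'.toFun (u, w) = (csGlueData A).inr
      (expT (mulVecE (slRealMatrix A * γ.toFun (2 * (angBPt u - 1)))
        (OpenPartialHomeomorph.univBall (0 : 𝔼 3) ε w)), angBPt u)) :
    Nonempty (ν'.Surgered ≃ₘ⟮𝓡 4, 𝓡 4⟯ gompfSphere A γ) := by
  have hε₁ := twistRadius_pos A γ
  set κ := ε / twistRadius A γ with hκ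
  have hκ₀ : 0 < κ := div_pos hε hε₁
  -- the values of the Gompf tube of `γ`
  have hν₁ : ∀ (u : 𝕊 1) (v : 𝔼 3), (sectionCircleNbhd A γ).toFun (u, v) = secNbhdFun A γ (u, v) :=
    fun u v ↦ rfl
  rcases le_or_gt κ 1 with hκ1 | hκ1
  · -- `ν' = ν_γ ∘ rescale κ` on the unit ball
    refine ((sectionCircleNbhd A γ).nonempty_diffeomorph_surgered_of_eqOn_twist
      (rescaleTube hε₁ κ) ν' fun u w hw ↦ ?_).map Diffeomorph.symm
    have hz : ‖κ • OpenPartialHomeomorph.univBall (0 : 𝔼 3) (twistRadius A γ) w‖ < twistRadius A γ := by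
      rw [norm_smul, Real.norm_of_nonneg hκ₀.le]
      calc κ * ‖OpenPartialHomeomorph.univBall (0 : 𝔼 3) (twistRadius A γ) w‖
          ≤ 1 * ‖OpenPartialHomeomorph.univBall (0 : 𝔼 3) (twistRadius A γ) w‖ :=
            mul_le_mul_of_nonneg_right hκ1 (norm_nonneg _)
        _ < twistRadius A γ := by rw [one_mul]; exact norm_univBall_zero_lt hε₁ w
    rw [rescaleTube_apply_of_norm_le hε₁ hκ₀ hκ1 u hw.le, hν₁]
    by_cases hu : u = ptA
    · subst hu
      rw [hνB _ ptA_ne_ptB, secNbhdFun_of_ne_ptB_eq γ ptA_ne_ptB,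
        univBall_symm_apply_of_norm_lt hε₁ hz, univBall_eq_smul_univBall hε hε₁]
    · rw [hνA _ hu, secNbhdFun_of_ne_ptA_eq γ hu, univBall_symm_apply_of_norm_lt hε₁ hz,
        univBall_eq_smul_univBall hε hε₁]
  · -- `ν_γ = ν' ∘ rescale κ⁻¹` on the unit ball
    have hκ' : 0 < κ⁻¹ := inv_pos.2 hκ₀
    have hκ'1 : κ⁻¹ ≤ 1 := inv_le_one_of_one_le₀ hκ1.le
    refine ν'.nonempty_diffeomorph_surgered_of_eqOn_twist (rescaleTube hε κ⁻¹)
      (sectionCircleNbhd A γ) fun u w hw ↦ ?_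
    have hz : ‖κ⁻¹ • OpenPartialHomeomorph.univBall (0 : 𝔼 3) ε w‖ < ε := by
      rw [norm_smul, Real.norm_of_nonneg hκ'.le]
      calc κ⁻¹ * ‖OpenPartialHomeomorph.univBall (0 : 𝔼 3) ε w‖
          ≤ 1 * ‖OpenPartialHomeomorph.univBall (0 : 𝔼 3) ε w‖ :=
            mul_le_mul_of_nonneg_right hκ'1 (norm_nonneg _)
        _ < ε := by rw [one_mul]; exact norm_univBall_zero_lt hε w
    have hsc : κ⁻¹ • OpenPartialHomeomorph.univBall (0 : 𝔼 3) ε w =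
        OpenPartialHomeomorph.univBall (0 : 𝔼 3) (twistRadius A γ) w := by
      rw [univBall_eq_smul_univBall hε hε₁ w, smul_smul, ← hκ, inv_mul_cancel₀ hκ₀.ne', one_smul]
    rw [rescaleTube_apply_of_norm_le hε hκ' hκ'1 u hw.le, hν₁]
    by_cases hu : u = ptA
    · subst hu
      rw [hνB _ ptA_ne_ptB, secNbhdFun_of_ne_ptB_eq γ ptA_ne_ptB,
        univBall_symm_apply_of_norm_lt hε hz, hsc]
    · rw [hνA _ hu, secNbhdFun_of_ne_ptA_eq γ hu, univBall_symm_apply_of_norm_lt hε hz, hsc]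

end Rescale

/-! ### `[β₁] = [β.deltaLeft 1]` -/

section Homotopy

variable {B : Matrix.SpecialLinearGroup (Fin 3) ℤ} (β : SmoothMatrixPath (slRealMatrix B))

/-- The segment from `1` to `Δ` is `t ↦ Δ_t`. [folklore] -/
theorem linearPath_gompfDeltaReal_one (t : ℝ) : linearPath (gompfDeltaReal 1) t = gompfDeltaReal t := by
  ext i j
  fin_cases i <;> fin_cases j <;> simp [linearPath, gompfDeltaReal]

/-- **Values of `β.deltaLeft 1`**: `Δ_{S(2θ - 1)} β(2θ)` (`S` the smooth transition). [folklore] -/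
theorem deltaLeft_one_toFun (θ : ℝ) :
    (β.deltaLeft 1).toFun θ = gompfDeltaReal (Real.smoothTransition (2 * θ - 1)) * β.toFun (2 * θ) := by
  show (linearStraighteningPath (slRealMatrix (gompfDelta ^ (1 : ℤ)))
      (isLinearlyStraightenable_gompfDelta_zpow 1)).toFun (2 * θ - 1) * β.toFun (2 * θ) = _
  rw [linearStraighteningPath_toFun, slRealMatrix_gompfDelta_zpow_one, linearPath_gompfDeltaReal_one]

/-- **`[β₁] = [β.deltaLeft 1]` as straightenings of `Δ B`.** Both paths are of the form
`θ ↦ Δ_{a(θ)} β(b(θ))` for parameter paths `(a, b)` in the unit square from `(0, 0)` to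
`(1, ≥ 1)`; interpolating the parameter paths linearly is a homotopy rel end points through
matrices of positive determinant. [cite: GompfAGT2010, §4 ¶3 (τ·σ for the row move)] -/
theorem deltaTwistPath_homotopic_deltaLeft_one :
    (deltaTwistPath β).toPath.Homotopic (β.deltaLeft 1).toPath := by
  let a : ℝ → ℝ → ℝ := fun r θ ↦ (1 - r) * startProfile (θ / 2) + r * Real.smoothTransition (2 * θ - 1)
  let b : ℝ → ℝ → ℝ := fun r θ ↦ (1 + r) * θ
  have hdet : ∀ r θ, 0 < (gompfDeltaReal (a r θ) * β.toFun (b r θ)).det := fun r θ ↦ by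
    rw [Matrix.det_mul, det_gompfDeltaReal, one_mul]
    exact β.det_pos _
  have ha : Continuous fun p : I × I ↦ a p.1 p.2 := by
    have h1 := contDiff_startProfile.continuous
    have h2 : Continuous Real.smoothTransition := Real.smoothTransition.continuous
    simp only [a]
    fun_prop
  have hb : Continuous fun p : I × I ↦ b p.1 p.2 := by simp only [b]; fun_prop
  have hcont : Continuous fun p : I × I ↦
      (⟨gompfDeltaReal (a p.1 p.2) * β.toFun (b p.1 p.2), hdet _ _⟩ : PosDetMatrix 3) := by
    refine Continuous.subtype_mk (Continuous.matrix_mul ?_ (β.continuous.comp hb)) _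
    refine continuous_matrix fun i j ↦ ?_
    fin_cases i <;> fin_cases j <;> simp [gompfDeltaReal] <;>
      first | exact continuous_const | exact ha | exact ha.neg
  refine ⟨{ toFun := fun p ↦ ⟨gompfDeltaReal (a p.1 p.2) * β.toFun (b p.1 p.2), hdet _ _⟩
            continuous_toFun := hcont
            map_zero_left := fun θ ↦ Subtype.ext ?_
            map_one_left := fun θ ↦ Subtype.ext ?_
            prop' := fun r θ hθ ↦ Subtype.ext ?_ }⟩
  · show gompfDeltaReal (a 0 θ) * β.toFun (b 0 θ) = (deltaTwistPath β).toFun θ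
    simp only [a, b, sub_zero, one_mul, zero_mul, add_zero, deltaTwistPath_toFun]
  · show gompfDeltaReal (a 1 θ) * β.toFun (b 1 θ) = (β.deltaLeft 1).toFun θ
    rw [deltaLeft_one_toFun]
    simp only [a, b, sub_self, zero_mul, one_mul, zero_add]
    norm_num
  · show gompfDeltaReal (a r θ) * β.toFun (b r θ) = (deltaTwistPath β).toFun θ
    simp only [Set.mem_insert_iff, Set.mem_singleton_iff] at hθ
    rcases hθ with rfl | rfl
    · simp only [a, b, Set.Icc.coe_zero, zero_div, mul_zero, startProfile_zero,
        deltaTwistPath_toFun, β.eq_one 0 le_rfl, Matrix.mul_one]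
      rw [Real.smoothTransition.zero_of_nonpos (by norm_num), mul_zero, add_zero]
    · simp only [a, b, Set.Icc.coe_one, mul_one, deltaTwistPath_toFun]
      rw [startProfile_of_ge (by norm_num), Real.smoothTransition.one_of_one_le (by norm_num),
        mul_one, mul_one, sub_add_cancel, β.eq_self _ le_rfl,
        β.eq_self _ (by linarith [(r : ℝ) |> fun _ ↦ (unitInterval.nonneg r)])]

end Homotopy

/-! ### The framed row move, conditionally on the fishtail regluing -/

section RowMove

variable (B : Matrix.SpecialLinearGroup (Fin 3) ℤ) (β : SmoothMatrixPath (slRealMatrix B))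

/-- **The half `{re z₂ < 0} × (1/2, 3/2)` of the second cylinder**: an open neighbourhood of every
far sliver, missing the section `{1} × (1/2, 3/2)`, and preserved by all twists along the tori
`{z₂ = const}` (they do not move `z₂`). [folklore] -/
def halfCylTwo : TopologicalSpace.Opens (ThreeTorus × ↥mappingTorusPieceTwo) :=
  ⟨{b | (((b.1.2.1 : Circle) : ℂ)).re < 0},
    isOpen_lt (((Complex.continuous_re.comp continuous_subtype_val).comp
      (continuous_fst.comp continuous_snd)).comp continuous_fst) continuous_const⟩

/-- Membership in the half cylinder. [folklore] -/
@[simp] theorem mem_halfCylTwo_iff {b : ThreeTorus × ↥mappingTorusPieceTwo} :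
    b ∈ halfCylTwo ↔ (((b.1.2.1 : Circle) : ℂ)).re < 0 :=
  Iff.rfl

/-- Points of the half cylinder are off the section `{1} × (1/2, 3/2)`. [folklore] -/
theorem fst_ne_one_of_mem_halfCylTwo {b : ThreeTorus × ↥mappingTorusPieceTwo} (hb : b ∈ halfCylTwo) :
    b.1 ≠ 1 := fun h ↦ by
  rw [mem_halfCylTwo_iff, h] at hb
  norm_num at hb

/-- **The sliver of `(B, β)` lies in the half cylinder** (`re z₂ ≤ cos (π - ε) = -cos ε < 0` on
the collar `S`). [folklore] -/
theorem fibreSliver_rowSupport_subset : fibreSliver (rowSupport B β) ⊆ halfCylTwo := by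
  intro b hb
  have h1 : (((b.1.2.1 : Circle) : ℂ)).re ≤ Real.cos (π - twistRadius B β) := hb.1
  have h2 : 0 < Real.cos (twistRadius B β) := Real.cos_pos_of_mem_Ioo
    ⟨by linarith [twistRadius_pos B β, Real.pi_pos], twistRadius_lt_pi_div_two B β⟩
  rw [Real.cos_pi_sub] at h1
  show (((b.1.2.1 : Circle) : ℂ)).re < 0
  linarith

/-- A sliver twist by a twist along the tori `{z₂ = const}` preserves the half cylinder. [folklore] -/
theorem sliverTwist_torusTwist_mem_halfCylTwo (F : Circle → Circle)
    {b : ThreeTorus × ↥mappingTorusPieceTwo} (hb : b ∈ halfCylTwo) :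
    sliverTwist (torusTwist F) b ∈ halfCylTwo := by
  by_cases h : 1 < ((b.2 : ℝ))
  · rw [sliverTwist_of_one_lt _ h, mem_halfCylTwo_iff]
    dsimp only
    rw [torusTwist_snd_fst]
    exact hb
  · rwa [sliverTwist_of_le_one _ (not_lt.1 h)]

/-- The reparametrised second cylinder of `CSTorus (Δ B)` takes the half cylinder off the section
circle. [folklore] -/
theorem rowCylB_not_mem_range_sectionCircle {b : ThreeTorus × ↥mappingTorusPieceTwo}
    (hb : b ∈ halfCylTwo) : rowCylB B β b ∉ range (sectionCircle (deltaMul B) (deltaTwistPath β)) :=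
  fun h ↦ fst_ne_one_of_mem_halfCylTwo hb (rowCylB_mem_range_sectionCircle B β h)

/-- The canonical second cylinder of `CSTorus B` takes the half cylinder off the section circle. [folklore] -/
theorem inr_not_mem_range_sectionCircle {b : ThreeTorus × ↥mappingTorusPieceTwo}
    (hb : b ∈ halfCylTwo) : (csGlueData B).inr b ∉ range (sectionCircle B β) := by
  intro h
  refine fst_ne_one_of_mem_halfCylTwo hb ?_
  rw [range_sectionCircle] at h
  rcases h with ⟨a, ha, hab⟩ | ⟨b', hb', hbb⟩
  · obtain ⟨ha1, -⟩ := mem_prod.1 ha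
    rw [mem_singleton_iff] at ha1
    rcases (mappingTorusGlued_inl_eq_inr_iff _ _ a b).1 hab with ⟨-, h⟩ | ⟨-, h⟩
    · rw [h, ha1]
    · rw [h, ha1, torusDiffeomorph_apply_one]
  · obtain ⟨hb1, -⟩ := mem_prod.1 hb'
    rw [mem_singleton_iff] at hb1
    rw [← (csGlueData B).inr_injective hbb, hb1]

/-- **The fishtail regluing relation of `X^σ_B = gompfSphere B β`** (Gompf 2010, Thm 2.1 / Lemma
2.2, in the tree's relational language): between the surgered open set `X ∖ Σ_X`
(`(sectionCircleNbhd B β).localOpens (rowOpens B β)`, the surgery of `CSTorus B` minus the fibre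
sliver `inr (S × {1})`) and the half `{re z₂ < 0} × (1/2, 3/2)` of the second cylinder (a
neighbourhood of the sliver): `x ∼ b :⟺ b ∉ S × {1} ∧ x = inl (inr (sliverTwist δ⁻¹ b))` — "cut
along an `M`-fiber and reglue by `δ`". Theorem 2.1 for `(B, β)` is the statement that `X` itself
carries an open gluing along this relation (hypothesis `hX` below), and Lemma 2.2 provides it
through `IsOpenGluingWith.reglue_of_sliverTwisting`
(`nonempty_diffeomorph_gompfSphere_deltaLeft_one_of_twistingDiffeo`). [cite: GompfAGT2010, Thm 2.1 (proof) and Lemma 2.2] -/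
def rowRel (x : ↥((sectionCircleNbhd B β).localOpens (rowOpens B β))) (b : ↥halfCylTwo) : Prop :=
  (b : ThreeTorus × ↥mappingTorusPieceTwo) ∉ fibreSliver (rowSupport B β) ∧
    ∃ a : ↥(sectionCircleNbhd B β).complement,
      (a : CSTorus B) = (csGlueData B).inr (sliverTwist (rowDehn B β).symm b) ∧
        (x : (sectionCircleNbhd B β).Surgered) = (sectionCircleNbhd B β).glueData.inl a

/-- **Gompf's framed row move `X^σ_B ≅ X^{τ·σ}_{Δ B}`, from the fishtail regluing of `X^σ_B`.**
If `X = gompfSphere B β` is an open gluing of `X` minus the fibre sliver and of the half second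
cylinder along `rowRel B β` (which is what the fishtail neighbourhood and Lemma 2.2 of Gompf's
proof of Theorem 2.1 provide: "`X^ε_φ` is unchanged if we cut along this face and reglue by the
given Dehn twist"), then `gompfSphere B β ≃ₘ gompfSphere (Δ B) (β.deltaLeft 1)` — the hypothesis
`h1` of `gompf2010_framedTwist_of_one` for `(B, β)`. Proof: the surgered `CSTorus (Δ B)` along the
transported tube is an open gluing along the same relation
(`IsOpenGluingWith.sliver_reglue_surgered_opens`), so the two are diffeomorphic by uniqueness of
open gluings; the transported tube is Gompf's tube of `Δ B` framed by `β₁ = Δ_μ β` with another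
radius (`transport_secNbhd_of_ne_ptA/B`, `nonempty_diffeomorph_gompfSphere_of_gompfForm`); and
`[β₁] = [β.deltaLeft 1]` (`deltaTwistPath_homotopic_deltaLeft_one`, W). [cite: GompfAGT2010, Thm 2.1 and §4 ¶3 (X^{τ·σ}_B = X^σ_A for B = Δ A)] -/
theorem nonempty_diffeomorph_gompfSphere_deltaLeft_one_of_reglue
    (hX : ∃ (eU : ↥((sectionCircleNbhd B β).localOpens (rowOpens B β)) → gompfSphere B β)
        (eV : ↥halfCylTwo → gompfSphere B β),
      IsOpenGluingWith (𝓡 4) (ModelWithCorners.prod 𝓣 𝓘(ℝ, ℝ)) (𝓡 4) (rowRel B β) eU eV) :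
    Nonempty (gompfSphere B β ≃ₘ⟮𝓡 4, 𝓡 4⟯ gompfSphere (gompfDelta ^ (1 : ℤ) * B) (β.deltaLeft 1)) := by
  have hS : IsClosed (rowSupport B β) := isClosed_farSupport _
  have hgS : ∀ y ∉ rowSupport B β, rowDehn B β y = y := fun y hy ↦ farDehn_eq_self _ _ hy
  obtain ⟨Θ, hΘA, hΘB⟩ := (isOpenGluingWith_csTorus B).exists_sliverDiffeomorph (rowDehn B β)
    (isOpenGluingWith_csTorus_rowDehn B β) hS hgS (isClosed_image_rowSliver B β)
    (isClosed_image_rowSliver' B β)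
  have hνU := sectionCircleNbhd_mem_rowOpens B β
  obtain ⟨Ψ, hΨl, hΨr⟩ := CircleNbhd.exists_diffeomorph_localOpens (sectionCircleNbhd B β)
    (transportedTube B β Θ hΘA hΘB) Θ hνU (fun q ↦ rfl)
  have hB2 := (isOpenGluingWith_csTorus B).sliver_reglue_surgered_opens (rowDehn B β)
    (isOpenGluingWith_csTorus_rowDehn B β) (isClosed_image_rowSliver B β)
    (isClosed_image_rowSliver' B β) Θ hΘA hΘB (sectionCircleNbhd B β)
    (transportedTube B β Θ hΘA hΘB) hνU (fun q ↦ rfl) Ψ hΨl hΨr halfCylTwo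
    (fibreSliver_rowSupport_subset B β) (fun b hb ↦ rowCylB_not_mem_range_sectionCircle B β hb)
  have hB2' : IsOpenGluingWith (𝓡 4) (ModelWithCorners.prod 𝓣 𝓘(ℝ, ℝ)) (𝓡 4) (rowRel B β)
      (fun x ↦ (Ψ x : (transportedTube B β Θ hΘA hΘB).Surgered))
      ((transportedTube B β Θ hΘA hΘB).glueData.inl ∘
        opensToComplement (transportedTube B β Θ hΘA hΘB) (rowCylB B β) halfCylTwo
          fun b hb ↦ rowCylB_not_mem_range_sectionCircle B β hb) := hB2
  obtain ⟨eU, eV, hXw⟩ := hX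
  obtain ⟨e₁, -, -⟩ := hXw.exists_diffeomorph_apply_eq hB2'
  have e₂ := nonempty_diffeomorph_gompfSphere_of_gompfForm (deltaTwistPath β) (twistRadius_pos B β)
    (transportedTube B β Θ hΘA hΘB)
    (fun u hu w ↦ transport_secNbhd_of_ne_ptA B β Θ hΘA hu w)
    (fun u hu w ↦ transport_secNbhd_of_ne_ptB B β Θ hΘB hu w)
  have e₃ := gompf2010_straightening_invariance_holds _ _ _ (deltaTwistPath_homotopic_deltaLeft_one β)
  exact nonempty_diffeomorph_trans ⟨e₁⟩ (nonempty_diffeomorph_trans e₂ e₃)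

/-- **Gompf's framed row move from a twisting diffeomorphism** (the form in which Lemma 2.2
delivers Theorem 2.1): if some diffeomorphism `G` of `X ∖ Σ_X` (`X = gompfSphere B β`, `Σ_X` the
sliver of the surgered mapping torus) satisfies `G (inl (inr b)) = inl (inr (sliverTwist δ b))` for
`b` in the half second cylinder off the sliver, then
`gompfSphere B β ≃ₘ gompfSphere (Δ B) (β.deltaLeft 1)`. [cite: GompfAGT2010, Lemma 2.2 and Thm 2.1 (proof, last paragraph)] -/
theorem nonempty_diffeomorph_gompfSphere_deltaLeft_one_of_twistingDiffeo
    (G : ↥((sectionCircleNbhd B β).localOpens (rowOpens B β)) ≃ₘ⟮𝓡 4, 𝓡 4⟯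
      ↥((sectionCircleNbhd B β).localOpens (rowOpens B β)))
    (hG : ∀ (x : ↥((sectionCircleNbhd B β).localOpens (rowOpens B β))) (b : ↥halfCylTwo),
      (b : ThreeTorus × ↥mappingTorusPieceTwo) ∉ fibreSliver (rowSupport B β) →
        (x : (sectionCircleNbhd B β).Surgered) = (sectionCircleNbhd B β).glueData.inl
          (opensToComplement (sectionCircleNbhd B β) (csGlueData B).inr halfCylTwo
            (fun _ hb ↦ inr_not_mem_range_sectionCircle B β hb) b) →
          ∃ a' : ↥(sectionCircleNbhd B β).complement,
            (a' : CSTorus B) = (csGlueData B).inr (sliverTwist (rowDehn B β) b) ∧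
              (G x : (sectionCircleNbhd B β).Surgered) = (sectionCircleNbhd B β).glueData.inl a') :
    Nonempty (gompfSphere B β ≃ₘ⟮𝓡 4, 𝓡 4⟯ gompfSphere (gompfDelta ^ (1 : ℤ) * B) (β.deltaLeft 1)) := by
  refine nonempty_diffeomorph_gompfSphere_deltaLeft_one_of_reglue B β ⟨_, _,
    (isOpenGluingWith_csTorus B).reglue_of_sliverTwisting (rowDehn B β) (g' := (rowDehn B β).symm)
      (fun y ↦ (rowDehn B β).apply_symm_apply y) (isClosed_image_rowSliver B β)
      (sectionCircleNbhd B β) (sectionCircleNbhd_mem_rowOpens B β) halfCylTwo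
      (fibreSliver_rowSupport_subset B β) (fun b hb ↦ inr_not_mem_range_sectionCircle B β hb)
      (fun b hb ↦ ?_) G hG⟩
  rw [rowDehn, coe_farDehn_symm]
  exact sliverTwist_torusTwist_mem_halfCylTwo _ hb

end RowMove

end Literature.Topology.FourManifolds
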